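import Summits.Ventures.Crystal3D.Bulk.RadiusTwoBarlowHolds
import Summits.Ventures.Crystal3D.Theorems.StickyWulffConstantGenericWallFloorSharedTriangle
import Summits.Ventures.Crystal3D.Theorems.StickyWulffConstantTextureLiminfFluxDrift
import HarnessLib

/-!
# L-coh: a ball touching PERFECT balls of two NON-CO-AXIAL fcc grains is not the centre of a Barlow radius-2 patch — hence
# it has a non-close-packed ball within contact distance 2 (lane T, crux `TextureLiminf`, stmt-Ventures-19483; `stub_textureBuild`'s
# hazard ledger (a), cf-p1 ROUTE.md §73.9 (i) «L-coh» / §73.9a)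

HONEST FRAMING. Venture `Summits/Ventures/Crystal3D` (cell `crystal3d-full`), helper `--supports` the crux `TextureLiminf`
(stmt-Ventures-19483) of `route-Ventures-StickyWulffConstant`, registered line `TexShadow`, stub `stub_textureBuild` (XL assembly).
Pure proof, standard axioms; rung credit only; F-C1 not moved.

WHY (ROUTE §73.9 (i)): in `stub_textureBuild` the CHARGED interface area of the texture must be bounded by the number of
`L12`-defective balls near it (`≤ 26·Def`); what makes a ball near a charged (non-co-axial) interface defective is exactly this lemma
(§73.9a: «x within 1 of a perfect-f ball b_f and of a perfect-g ball b_g with the frames ¬CoAx ⇒ x is L12-defective; proof: else the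
2-ball of x is a Barlow piece containing the full 12-shells of b_f and b_g, each of which contains an in-layer unit triangle lying in
Λ_f resp. Λ_g ⇒ `coaxial_of_shared_triangle` ⇒ CoAx»).  Here «perfect ball of grain `Λ = A·Λ₀ + t`» := the ball and its twelve
contact neighbours lie on `Λ`.

* `add_triangularVec₁_mem_barlowStacking` / `₂` — in-plane unit steps stay in a Barlow stacking;
* `exists_neighbor_eq_add_pullback` — if an isometry `g` carries a 12-coordinated ball `j` and its contact shell into a Barlow stacking
  `S`, every unit step `w` of `S` at `g (x j)` pulls back to a contact neighbour: `x n = x j + g.linear⁻¹ w` (the twelve images ARE the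
  touching set of `g (x j)` in `S`, `ncard_touching_eq_twelve`; `g` is affine by Mazur–Ulam);
* **`not_isBarlowPatchCentre_of_two_grains`** — `i` touches `jf` (perfect in `Λ_f`) and `jg` (perfect in `Λ_g`), the two affine fcc
  lattices NOT co-axial ⇒ `¬ IsBarlowPatchCentre x i`;
* **`exists_not_closePacked_withinTwo_of_two_grains`** — hence (by `radiusTwoBarlow_holds`) some ball within contact distance `2` of
  `i` has a NON-close-packed first shell.
WHAT THIS IS NOT: not the area bound of hazard (a) (that is counting with `card_filter_withinTwo_le`), not `stub_textureBuild`; F-C1 not moved.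
-/

noncomputable section

namespace Summit.Ventures.Crystal3D.Theorems

open Summit.Ventures.Crystal3D Finset
open Literature.MathematicalPhysics.StatisticalMechanics (fccStacking barlowStacking barlowPos IsHaggSeq triangularVec₁
  triangularVec₂ ncard_touching_eq_twelve)
open scoped InnerProductSpace

/-- An in-plane unit step `u₁` stays in the Barlow stacking. -/
theorem add_triangularVec₁_mem_barlowStacking {σ : ℤ → ℤ} {p : EuclideanSpace ℝ (Fin 3)}
    (hp : p ∈ barlowStacking 1 (Real.sqrt (2 / 3)) σ) :
    p + triangularVec₁ 1 ∈ barlowStacking 1 (Real.sqrt (2 / 3)) σ := by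
  obtain ⟨k, i, j, rfl⟩ := hp
  exact ⟨k, i + 1, j, by simp only [barlowPos]; push_cast; module⟩

/-- An in-plane unit step `u₂` stays in the Barlow stacking. -/
theorem add_triangularVec₂_mem_barlowStacking {σ : ℤ → ℤ} {p : EuclideanSpace ℝ (Fin 3)}
    (hp : p ∈ barlowStacking 1 (Real.sqrt (2 / 3)) σ) :
    p + triangularVec₂ 1 ∈ barlowStacking 1 (Real.sqrt (2 / 3)) σ := by
  obtain ⟨k, i, j, rfl⟩ := hp
  exact ⟨k, i, j + 1, by simp only [barlowPos]; push_cast; module⟩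

/-- `⟪u₁, u₂⟫ = ½` (the two in-plane generators make an angle of `π/3`). -/
theorem inner_triangularVec₁_triangularVec₂_one : ⟪triangularVec₁ (1 : ℝ), triangularVec₂ (1 : ℝ)⟫_ℝ = 1 / 2 := by
  rw [EuclideanSpace.inner_eq_star_dotProduct]
  simp [triangularVec₁, triangularVec₂, Fin.sum_univ_three, dotProduct]

/-- **Pull-back of a lattice step to a contact neighbour.**  `x` a unit packing, `g` an isometry of `ℝ³` carrying the ball `j` and its
twelve contact neighbours into the Barlow stacking `S(σ)`; if `g (x j) + w ∈ S(σ)` with `‖w‖ = 1`, then some contact neighbour `n`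
of `j` sits at `x n = x j + g.linear⁻¹ w`. -/
theorem exists_neighbor_eq_add_pullback {N : ℕ} {x : Fin N → EuclideanSpace ℝ (Fin 3)} (hx : IsUnitPacking x)
    {σ : ℤ → ℤ} (hσ : IsHaggSeq σ) (g : EuclideanSpace ℝ (Fin 3) ≃ᵢ EuclideanSpace ℝ (Fin 3)) {j : Fin N}
    (hj : g (x j) ∈ barlowStacking 1 (Real.sqrt (2 / 3)) σ)
    (hnb : ∀ n ∈ contactNeighbors x j, g (x n) ∈ barlowStacking 1 (Real.sqrt (2 / 3)) σ)
    (h12 : (contactNeighbors x j).card = 12) (w : EuclideanSpace ℝ (Fin 3))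
    (hw : g (x j) + w ∈ barlowStacking 1 (Real.sqrt (2 / 3)) σ) (hw1 : ‖w‖ = 1) :
    ∃ n ∈ contactNeighbors x j, x n = x j + g.toRealAffineIsometryEquiv.linearIsometryEquiv.symm w := by
  classical
  -- the touching set of `g (x j)` in the stacking has twelve elements
  set T : Set (EuclideanSpace ℝ (Fin 3)) :=
    {y | y ∈ barlowStacking 1 (Real.sqrt (2 / 3)) σ ∧ dist (g (x j)) y = 1} with hT
  have hhB : Real.sqrt (2 / 3) ^ 2 = 2 / 3 * (1 : ℝ) ^ 2 := by rw [Real.sq_sqrt (by norm_num)]; ring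
  have hTcard : T.ncard = 12 := ncard_touching_eq_twelve hσ one_pos hhB hj
  have hTfin : T.Finite := Set.finite_of_ncard_ne_zero (by rw [hTcard]; norm_num)
  -- the images of the twelve neighbours lie in `T`, injectively
  set I : Finset (EuclideanSpace ℝ (Fin 3)) := (contactNeighbors x j).image fun n => g (x n) with hI
  have hinj : Set.InjOn (fun n => g (x n)) ↑(contactNeighbors x j) := by
    intro n hn n' hn' h
    have h' : x n = x n' := g.injective h
    by_contra hne
    have h1 : 1 ≤ dist (x n) (x n') := hx hne
    rw [h', dist_self] at h1
    exact absurd h1 (by norm_num)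
  have hIcard : I.card = 12 := by rw [hI, Finset.card_image_of_injOn hinj, h12]
  have hIT : (↑I : Set (EuclideanSpace ℝ (Fin 3))) ⊆ T := by
    intro y hy
    rw [Finset.mem_coe, hI, Finset.mem_image] at hy
    obtain ⟨n, hn, rfl⟩ := hy
    refine ⟨hnb n hn, ?_⟩
    rw [g.dist_eq]
    exact ((mem_contactNeighbors x).1 hn).2
  have hIeq : (↑I : Set (EuclideanSpace ℝ (Fin 3))) = T :=
    Set.eq_of_subset_of_ncard_le hIT (by rw [hTcard, Set.ncard_coe_finset, hIcard]) hTfin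
  -- so `g (x j) + w ∈ T` is the image of a neighbour
  have hwT : g (x j) + w ∈ T := by
    refine ⟨hw, ?_⟩
    rw [dist_eq_norm, sub_add_cancel_left, norm_neg, hw1]
  rw [← hIeq, Finset.mem_coe, hI, Finset.mem_image] at hwT
  obtain ⟨n, hn, hne⟩ := hwT
  refine ⟨n, hn, ?_⟩
  -- `g` is affine (Mazur–Ulam): pull the step back through its linear part
  set G := g.toRealAffineIsometryEquiv with hG
  have hGg : ∀ p, G p = g p := fun p => by rw [hG, IsometryEquiv.coeFn_toRealAffineIsometryEquiv]
  have hstep : G (G.linearIsometryEquiv.symm w +ᵥ x j) = w +ᵥ G (x j) := by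
    rw [G.map_vadd, LinearIsometryEquiv.apply_symm_apply]
  have h1 : G (x n) = G (G.linearIsometryEquiv.symm w +ᵥ x j) := by
    rw [hstep, hGg, hGg, hne, vadd_eq_add, add_comm]
  have h2 := G.injective h1
  rw [h2, vadd_eq_add, add_comm]

/-- **L-coh.**  In a unit packing, a ball `i` touching a PERFECT ball `jf` of the affine fcc grain `Λ_f = A_f·Λ₀ + t_f` (the ball and its
twelve contact neighbours on `Λ_f`) and a perfect ball `jg` of `Λ_g`, with `Λ_f`, `Λ_g` NOT co-axial (no common moved Barlow frame), is NOT
the centre of a Barlow radius-2 patch. -/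
theorem not_isBarlowPatchCentre_of_two_grains {N : ℕ} {x : Fin N → EuclideanSpace ℝ (Fin 3)} (hx : IsUnitPacking x)
    {i jf jg : Fin N} (hjf : jf ∈ contactNeighbors x i) (hjg : jg ∈ contactNeighbors x i)
    (hf12 : (contactNeighbors x jf).card = 12) (hg12 : (contactNeighbors x jg).card = 12)
    {Af Ag : EuclideanSpace ℝ (Fin 3) ≃ₗᵢ[ℝ] EuclideanSpace ℝ (Fin 3)} {tf tg : EuclideanSpace ℝ (Fin 3)}
    (hf0 : x jf ∈ (fun p => Af p + tf) '' fccStacking 1 (Real.sqrt (2 / 3)))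
    (hf : ∀ n ∈ contactNeighbors x jf, x n ∈ (fun p => Af p + tf) '' fccStacking 1 (Real.sqrt (2 / 3)))
    (hg0 : x jg ∈ (fun p => Ag p + tg) '' fccStacking 1 (Real.sqrt (2 / 3)))
    (hg : ∀ n ∈ contactNeighbors x jg, x n ∈ (fun p => Ag p + tg) '' fccStacking 1 (Real.sqrt (2 / 3)))
    (hnc : ¬ ∃ (L : EuclideanSpace ℝ (Fin 3) ≃ₗᵢ[ℝ] EuclideanSpace ℝ (Fin 3)) (r₁ r₂ : EuclideanSpace ℝ (Fin 3))
        (σ σ' : ℤ → ℤ), IsHaggSeq σ ∧ IsHaggSeq σ' ∧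
        (fun p => Af p + tf) '' fccStacking 1 (Real.sqrt (2 / 3)) ⊆
          (fun p => L p + r₁) '' barlowStacking 1 (Real.sqrt (2 / 3)) σ ∧
        (fun p => Ag p + tg) '' fccStacking 1 (Real.sqrt (2 / 3)) ⊆
          (fun p => L p + r₂) '' barlowStacking 1 (Real.sqrt (2 / 3)) σ') :
    ¬ IsBarlowPatchCentre x i := by
  rintro ⟨σ, hσ, g, hmem⟩
  set L := g.toRealAffineIsometryEquiv.linearIsometryEquiv with hL
  -- the two touching balls and their shells are in the patch
  have hin : ∀ j ∈ contactNeighbors x i, g (x j) ∈ barlowStacking 1 (Real.sqrt (2 / 3)) σ ∧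
      ∀ n ∈ contactNeighbors x j, g (x n) ∈ barlowStacking 1 (Real.sqrt (2 / 3)) σ :=
    fun j hj => ⟨hmem j (Or.inr (Or.inl hj)), fun n hn => hmem n (Or.inr (Or.inr ⟨j, hj, hn⟩))⟩
  -- pull the two in-plane generators back to the packing
  set a := L.symm (triangularVec₁ 1) with ha
  set b := L.symm (triangularVec₂ 1) with hb
  have step : ∀ j ∈ contactNeighbors x i, (contactNeighbors x j).card = 12 →
      (∃ n ∈ contactNeighbors x j, x n = x j + a) ∧ (∃ n ∈ contactNeighbors x j, x n = x j + b) := by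
    intro j hj h12
    obtain ⟨hj', hnb⟩ := hin j hj
    exact ⟨exists_neighbor_eq_add_pullback hx hσ g hj' hnb h12 _ (add_triangularVec₁_mem_barlowStacking hj')
        norm_triangularVec₁_one,
      exists_neighbor_eq_add_pullback hx hσ g hj' hnb h12 _ (add_triangularVec₂_mem_barlowStacking hj')
        norm_triangularVec₂_one⟩
  obtain ⟨⟨nf₁, hnf₁, ef₁⟩, ⟨nf₂, hnf₂, ef₂⟩⟩ := step jf hjf hf12
  obtain ⟨⟨ng₁, hng₁, eg₁⟩, ⟨ng₂, hng₂, eg₂⟩⟩ := step jg hjg hg12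
  have hna : ‖a‖ = 1 := by rw [ha, LinearIsometryEquiv.norm_map]; exact norm_triangularVec₁_one
  have hnb' : ‖b‖ = 1 := by rw [hb, LinearIsometryEquiv.norm_map]; exact norm_triangularVec₂_one
  have hab : ⟪a, b⟫_ℝ = 1 / 2 := by
    rw [ha, hb, LinearIsometryEquiv.inner_map_map]; exact inner_triangularVec₁_triangularVec₂_one
  refine hnc (coaxial_of_shared_triangle Af Ag tf tg (x jf) (x jg) a b hf0 ?_ ?_ hg0 ?_ ?_ hna hnb' hab)
  · rw [← ef₁]; exact hf nf₁ hnf₁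
  · rw [← ef₂]; exact hf nf₂ hnf₂
  · rw [← eg₁]; exact hg ng₁ hng₁
  · rw [← eg₂]; exact hg ng₂ hng₂

/-- **L-coh, defect form.**  Under the hypotheses of `not_isBarlowPatchCentre_of_two_grains`, some ball within contact distance `2` of `i`
has a NON-close-packed first shell (by the radius-2 lemma `radiusTwoBarlow_holds`). -/
theorem exists_not_closePacked_withinTwo_of_two_grains {N : ℕ} {x : Fin N → EuclideanSpace ℝ (Fin 3)}
    (hx : IsUnitPacking x) {i jf jg : Fin N} (hjf : jf ∈ contactNeighbors x i) (hjg : jg ∈ contactNeighbors x i)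
    (hf12 : (contactNeighbors x jf).card = 12) (hg12 : (contactNeighbors x jg).card = 12)
    {Af Ag : EuclideanSpace ℝ (Fin 3) ≃ₗᵢ[ℝ] EuclideanSpace ℝ (Fin 3)} {tf tg : EuclideanSpace ℝ (Fin 3)}
    (hf0 : x jf ∈ (fun p => Af p + tf) '' fccStacking 1 (Real.sqrt (2 / 3)))
    (hf : ∀ n ∈ contactNeighbors x jf, x n ∈ (fun p => Af p + tf) '' fccStacking 1 (Real.sqrt (2 / 3)))
    (hg0 : x jg ∈ (fun p => Ag p + tg) '' fccStacking 1 (Real.sqrt (2 / 3)))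
    (hg : ∀ n ∈ contactNeighbors x jg, x n ∈ (fun p => Ag p + tg) '' fccStacking 1 (Real.sqrt (2 / 3)))
    (hnc : ¬ ∃ (L : EuclideanSpace ℝ (Fin 3) ≃ₗᵢ[ℝ] EuclideanSpace ℝ (Fin 3)) (r₁ r₂ : EuclideanSpace ℝ (Fin 3))
        (σ σ' : ℤ → ℤ), IsHaggSeq σ ∧ IsHaggSeq σ' ∧
        (fun p => Af p + tf) '' fccStacking 1 (Real.sqrt (2 / 3)) ⊆
          (fun p => L p + r₁) '' barlowStacking 1 (Real.sqrt (2 / 3)) σ ∧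
        (fun p => Ag p + tg) '' fccStacking 1 (Real.sqrt (2 / 3)) ⊆
          (fun p => L p + r₂) '' barlowStacking 1 (Real.sqrt (2 / 3)) σ') :
    ∃ j, WithinTwo x i j ∧ ¬ IsClosePackedShell x j := by
  by_contra h
  push Not at h
  exact not_isBarlowPatchCentre_of_two_grains hx hjf hjg hf12 hg12 hf0 hf hg0 hg hnc
    (radiusTwoBarlow_holds N x hx i h)

end Summit.Ventures.Crystal3D.Theorems

end
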